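import Literature.AlgebraicGeometry.ModuliOfAbelianVarieties.SiegelShimuraSetDissection
import Literature.AlgebraicGeometry.ModuliOfAbelianVarieties.SiegelHalfSwap
import Literature.AlgebraicGeometry.ModuliOfAbelianVarieties.SiegelPrincipalLevelNormal
import HarnessLib

/-!
# The pieces of the Siegel Shimura set: rational left factors, the two halves of a piece via the half-swap
# `γ₀ = diag(1_g, -1_g)`, and the arithmetic group of a piece at principal level `K_δ(N)`

Topic `AlgebraicGeometry/ModuliOfAbelianVarieties`; namespace `Literature.AlgebraicGeometry.ModuliOfAbelianVarieties`,
grouping sub-namespace `SiegelShimuraSet`.  Theorems only (no definition, no named fact, no instance, no `sorry`).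
Cell hodgecm-mathlib (D-0151): banked generic leaf toward row #60 `SiegelS1` (#60 road R60-13b, sequel of ★ R60-13
`SiegelShimuraSetDissection`); books 0.  HC_CM is proved only modulo the 7 printed citations until rung 0 closes.

Printed statement.  [Milne2005ShimuraVarieties] §6 p. 68 («`X = X⁺ ⊔ X⁻` … elements of `GSp(ℝ)` of negative
multiplier interchange `X⁺` and `X⁻`») and Lemma 5.13 p. 57 with footnote 41 («Now `[x, a] = [q⁻¹x, g]`»): passing
from the dissection of `G(ℚ)∖X × G(𝔸_f)/K` over ALL of `X = S^±` (★ R60-13 `SiegelShimuraSet.equivSigma`) to Milne's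
form over `X⁺ ≅ 𝔥_g` costs exactly the sign bookkeeping below: a class `[J, ξK]` with `J ∈ X⁻` equals
`[γ₀Jγ₀⁻¹, (γ₀ξ)K]` with `γ₀Jγ₀⁻¹ ∈ X⁺` (`γ₀ ∈ GSp_δ(ℚ)` the half-swap of ★ `SiegelHalfSwap`, multiplier `-1`), so
every double-coset piece `pieceMap δ K ξ` is the union of the `X⁺`-classes with representative `ξ` and those with
representative `γ₀ξ` — DISJOINT as soon as `Γ_ξ = GSp_δ(ℚ) ∩ ξKξ⁻¹` has positive multipliers (★ R60-13
`Piece.mem_C0_of_mk_eq_mk`), which §3 records for the principal levels: for `r ∈ K_δ(1)`,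
`Γ_r = Γ_{γ₀r} = GSp_δ(ℚ) ∩ K_δ(N)` (★ `principalLevelSubgroup_normal_in_one`; = `Γ_δ(N)` by ★ R60-11).
[Deligne1971TravauxShimura] 1.8 p. 129, 4.16 p. 150.

## References
* [Milne2005ShimuraVarieties] J. S. Milne, *Introduction to Shimura varieties* (2005), §5 Lemma 5.13 p. 57; §6 pp. 68–70.
* [Deligne1971TravauxShimura] P. Deligne, *Travaux de Shimura* (1971), 1.8 p. 129, 4.16 p. 150.
-/

set_option autoImplicit false

noncomputable section

open Function MulAction Matrix

namespace Literature.AlgebraicGeometry.ModuliOfAbelianVarieties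

open SiegelModuli (C0 realTypeForm mem_C0_iff)

namespace SiegelShimuraSet

variable {g : ℕ} (δ : Fin g → ℕ) (K : Subgroup (gspFinAdelic δ))

/-! ### §1. Rational left factors of a representative -/

/-- Conjugating the representative by a RATIONAL element conjugates the arithmetic group:
`γ ∈ Γ_{γ₀ξ} ↔ γ₀⁻¹ γ γ₀ ∈ Γ_ξ`. [cite: Milne2005ShimuraVarieties, Lemma 5.13 p. 57] -/
theorem mem_arithLevel_ratMul_iff (γ₀ : gspRational δ) (ξ : gspFinAdelic δ) (γ : gspRational δ) :
    γ ∈ arithLevel δ K (gspRationalToFinAdelic δ γ₀ * ξ) ↔ γ₀⁻¹ * γ * γ₀ ∈ arithLevel δ K ξ := by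
  rw [mem_arithLevel_iff, mem_arithLevel_iff, map_mul, map_mul, map_inv]
  have : (gspRationalToFinAdelic δ γ₀ * ξ)⁻¹ * gspRationalToFinAdelic δ γ * (gspRationalToFinAdelic δ γ₀ * ξ) =
      ξ⁻¹ * ((gspRationalToFinAdelic δ γ₀)⁻¹ * gspRationalToFinAdelic δ γ * gspRationalToFinAdelic δ γ₀) * ξ := by
    group
  rw [this]

/-- A rational left factor does not change the piece index: `GSp_δ(ℚ)·(γ₀ξ)·K = GSp_δ(ℚ)·ξ·K`.
[cite: Milne2005ShimuraVarieties, Lemma 5.13 p. 57] -/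
theorem indexOf_ratMul (γ₀ : gspRational δ) (ξ : gspFinAdelic δ) :
    indexOf δ K (gspRationalToFinAdelic δ γ₀ * ξ) = indexOf δ K ξ :=
  ((indexOf_eq_indexOf_iff δ K ξ _).2 ⟨γ₀, 1, K.one_mem, by rw [mul_one]⟩).symm

/-- `[J, ξK] = [γ₀Jγ₀⁻¹, (γ₀ξ)K]` for `γ₀ ∈ GSp_δ(ℚ)` («Now `[x, a] = [q⁻¹x, g]`»; ★ `mk_conjAct_smul` read from right
to left). [cite: Milne2005ShimuraVarieties, Lemma 5.13 p. 57 fn. 41] -/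
theorem mk_eq_mk_conjAct_ratMul (γ₀ : gspRational δ) (J : C0pm δ) (ξ : gspFinAdelic δ) :
    SiegelShimuraSet.mk δ K J ξ =
      SiegelShimuraSet.mk δ K (conjAct δ (gspRationalToReal δ γ₀) J) (gspRationalToFinAdelic δ γ₀ * ξ) :=
  (SiegelShimuraSet.mk_conjAct_smul δ K γ₀ J ξ).symm

/-! ### §2. The two halves of a piece via the half-swap `γ₀` -/

/-- The `iff` form of ★ `Piece.mem_C0_of_mk_eq_mk`: for `Δ ≤ GSp_δ(ℚ)` with POSITIVE real multipliers the half
`X⁺`/`X⁻` is an invariant of the class in `Δ∖S^±`. [cite: Milne2005ShimuraVarieties, §6 p. 68 and Lemma 5.13 p. 57] -/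
theorem Piece.mem_C0_iff_of_mk_eq_mk {Δ : Subgroup (gspRational δ)}
    (hΔ : ∀ γ ∈ Δ, ∃ ν : ℝˣ, 0 < (ν : ℝ) ∧
      IsMultiplier (realTypeForm δ) ((gspRationalToReal δ γ : gspReal δ) : GL (Fin g ⊕ Fin g) ℝ) ν)
    {J J' : C0pm δ} (h : Piece.mk δ Δ J = Piece.mk δ Δ J') :
    (J : Matrix (Fin g ⊕ Fin g) (Fin g ⊕ Fin g) ℝ) ∈ C0 δ ↔ (J' : Matrix (Fin g ⊕ Fin g) (Fin g ⊕ Fin g) ℝ) ∈ C0 δ :=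
  ⟨Piece.mem_C0_of_mk_eq_mk δ hΔ h.symm, Piece.mem_C0_of_mk_eq_mk δ hΔ h⟩

/-- A point of `S^±` lies in `X⁻` iff `-J ∈ X⁺`, i.e. iff it is NOT in `X⁺` (`g ≥ 1`; the halves are disjoint,
★ `neg_not_mem_C0_of_mem_C0`). [cite: Milne2005ShimuraVarieties, §6 p. 68 («X = X⁺ ⊔ X⁻»)] -/
theorem neg_coe_mem_C0_iff_not_mem (hg : 0 < g) (J : C0pm δ) :
    -(J : Matrix (Fin g ⊕ Fin g) (Fin g ⊕ Fin g) ℝ) ∈ C0 δ ↔ (J : Matrix (Fin g ⊕ Fin g) (Fin g ⊕ Fin g) ℝ) ∉ C0 δ := by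
  constructor
  · intro h hJ
    exact neg_not_mem_C0_of_mem_C0 hg hJ h
  · intro h
    exact (mem_C0pm_iff.1 J.2).resolve_left h

/-- **The half-swap moves `X⁻` onto `X⁺`** at the level of `conjAct`: `γ₀Jγ₀⁻¹ ∈ X⁺ ↔ -J ∈ X⁺` (`γ₀ = diag(1,-1)`,
multiplier `-1`; ★ `conjJ_halfSwap_mem_C0`, ★ `neg_conjJ_halfSwap_mem_C0`). [cite: Milne2005ShimuraVarieties, §6 p. 68] -/
theorem coe_conjAct_halfSwap_mem_C0_iff (J : C0pm δ) :
    ((conjAct δ (gspRationalToReal δ ⟨halfSwap ℚ g, halfSwap_mem_gspRational δ⟩) J : C0pm δ) :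
        Matrix (Fin g ⊕ Fin g) (Fin g ⊕ Fin g) ℝ) ∈ C0 δ ↔
      -(J : Matrix (Fin g ⊕ Fin g) (Fin g ⊕ Fin g) ℝ) ∈ C0 δ := by
  rw [coe_conjAct, gspRationalToReal_halfSwap]
  refine ⟨fun h => ?_, conjJ_halfSwap_mem_C0⟩
  have h2 := neg_conjJ_halfSwap_mem_C0 h
  have h1 : halfSwap ℝ g * halfSwap ℝ g = 1 := mul_eq_one_iff_eq_inv.2 (halfSwap_inv ℝ (g := g)).symm
  rwa [← conjJ_mul, h1, conjJ_one] at h2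

/-- `[J, ξK] = [γ₀Jγ₀⁻¹, (γ₀ξ)K]` for the half-swap `γ₀`: an `X⁻`-class with representative `ξ` IS an `X⁺`-class
with representative `γ₀ξ` (same piece index, `indexOf_ratMul`). [cite: Milne2005ShimuraVarieties, §6 p. 68 and Lemma 5.13 p. 57 fn. 41] -/
theorem mk_eq_mk_conjAct_halfSwap (J : C0pm δ) (ξ : gspFinAdelic δ) :
    SiegelShimuraSet.mk δ K J ξ =
      SiegelShimuraSet.mk δ K (conjAct δ (gspRationalToReal δ ⟨halfSwap ℚ g, halfSwap_mem_gspRational δ⟩) J)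
        (gspRationalToFinAdelic δ ⟨halfSwap ℚ g, halfSwap_mem_gspRational δ⟩ * ξ) :=
  mk_eq_mk_conjAct_ratMul δ K _ J ξ

/-- **A piece is the union of two `X⁺`-families**: `c` lies on the piece of `ξ` iff `c = [J, ξK]` or `c = [J, (γ₀ξ)K]`
for some `J ∈ X⁺` (no hypothesis on `Γ_ξ`). [cite: Milne2005ShimuraVarieties, Lemma 5.13 p. 57 and §6 p. 68] -/
theorem mem_range_pieceMap_iff_exists_mem_C0 (ξ : gspFinAdelic δ) (c : SiegelShimuraSet δ K) :
    c ∈ Set.range (pieceMap δ K ξ) ↔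
      ∃ J : C0pm δ, (J : Matrix (Fin g ⊕ Fin g) (Fin g ⊕ Fin g) ℝ) ∈ C0 δ ∧
        (c = SiegelShimuraSet.mk δ K J ξ ∨
          c = SiegelShimuraSet.mk δ K J (gspRationalToFinAdelic δ ⟨halfSwap ℚ g, halfSwap_mem_gspRational δ⟩ * ξ)) := by
  constructor
  · rintro ⟨p, rfl⟩
    induction p using Piece.ind with | h J' => ?_
    rw [pieceMap_mk]
    rcases mem_C0pm_iff.1 J'.2 with hJ' | hJ'
    · exact ⟨J', hJ', Or.inl rfl⟩
    · exact ⟨conjAct δ (gspRationalToReal δ ⟨halfSwap ℚ g, halfSwap_mem_gspRational δ⟩) J',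
        (coe_conjAct_halfSwap_mem_C0_iff δ J').2 hJ', Or.inr (mk_eq_mk_conjAct_halfSwap δ K J' ξ)⟩
  · rintro ⟨J, -, h | h⟩
    · exact ⟨Piece.mk δ _ J, by rw [pieceMap_mk, h]⟩
    · refine ⟨Piece.mk δ _ (conjAct δ (gspRationalToReal δ ⟨halfSwap ℚ g, halfSwap_mem_gspRational δ⟩⁻¹) J), ?_⟩
      rw [pieceMap_mk, h, mk_eq_mk_conjAct_ratMul δ K ⟨halfSwap ℚ g, halfSwap_mem_gspRational δ⟩ (conjAct δ _ J),
        ← conjAct_mul, ← map_mul, mul_inv_cancel, map_one, conjAct_one]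

/-- Within one `X⁺`-family the classes are governed by `Γ_ξ`: `[J, ξK] = [J′, ξK] ↔ [J] = [J′]` in `Γ_ξ∖S^±`
(★ `pieceMap_injective`). [cite: Milne2005ShimuraVarieties, Lemma 5.13 p. 57 fn. 40] -/
theorem mk_eq_mk_iff_piece (ξ : gspFinAdelic δ) (J J' : C0pm δ) :
    SiegelShimuraSet.mk δ K J ξ = SiegelShimuraSet.mk δ K J' ξ ↔
      Piece.mk δ (arithLevel δ K ξ) J = Piece.mk δ (arithLevel δ K ξ) J' := by
  rw [← pieceMap_mk, ← pieceMap_mk]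
  exact ⟨fun h => pieceMap_injective δ K ξ h, fun h => by rw [h]⟩

/-- **The two `X⁺`-families of a piece are disjoint** when `Γ_ξ` has positive multipliers (`g ≥ 1`):
`[J, ξK] ≠ [J′, (γ₀ξ)K]` for `J, J′ ∈ X⁺` — else `[J] = [γ₀⁻¹J′γ₀]` in `Γ_ξ∖S^±` with `γ₀⁻¹J′γ₀ ∈ X⁻`.
[cite: Milne2005ShimuraVarieties, §6 p. 68 and Lemma 5.13 p. 57] -/
theorem mk_ne_mk_halfSwap_mul (hg : 0 < g) (ξ : gspFinAdelic δ)
    (hΓ : ∀ γ ∈ arithLevel δ K ξ, ∃ ν : ℝˣ, 0 < (ν : ℝ) ∧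
      IsMultiplier (realTypeForm δ) ((gspRationalToReal δ γ : gspReal δ) : GL (Fin g ⊕ Fin g) ℝ) ν)
    {J J' : C0pm δ} (hJ : (J : Matrix (Fin g ⊕ Fin g) (Fin g ⊕ Fin g) ℝ) ∈ C0 δ)
    (hJ' : (J' : Matrix (Fin g ⊕ Fin g) (Fin g ⊕ Fin g) ℝ) ∈ C0 δ) :
    SiegelShimuraSet.mk δ K J ξ ≠
      SiegelShimuraSet.mk δ K J' (gspRationalToFinAdelic δ ⟨halfSwap ℚ g, halfSwap_mem_gspRational δ⟩ * ξ) := by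
  intro h
  set γ₀ : gspRational δ := ⟨halfSwap ℚ g, halfSwap_mem_gspRational δ⟩ with hγ₀
  have e : SiegelShimuraSet.mk δ K J' (gspRationalToFinAdelic δ γ₀ * ξ) =
      SiegelShimuraSet.mk δ K (conjAct δ (gspRationalToReal δ γ₀⁻¹) J') ξ := by
    rw [mk_eq_mk_conjAct_ratMul δ K γ₀ (conjAct δ (gspRationalToReal δ γ₀⁻¹) J'), ← conjAct_mul, ← map_mul,
      mul_inv_cancel, map_one, conjAct_one]
  rw [e, mk_eq_mk_iff_piece] at h
  have hmem := (Piece.mem_C0_iff_of_mk_eq_mk δ hΓ h).1 hJ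
  have hγ₀inv : γ₀⁻¹ = γ₀ := Subtype.ext (halfSwap_inv ℚ (g := g))
  rw [hγ₀inv, coe_conjAct_halfSwap_mem_C0_iff] at hmem
  exact neg_not_mem_C0_of_mem_C0 hg hJ' hmem

/-! ### §3. Principal levels: `Γ_r = GSp_δ(ℚ) ∩ K_δ(N)` for `r ∈ K_δ(1)`, and the half-swap lies in `K_δ(1)` -/

/-- `Γ_1 = GSp_δ(ℚ) ∩ K` (representative `1`). [cite: Milne2005ShimuraVarieties, Lemma 5.13 p. 57] -/
theorem arithLevel_one : arithLevel δ K 1 = K.comap (gspRationalToFinAdelic δ) := by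
  ext γ
  rw [mem_arithLevel_iff, Subgroup.mem_comap, inv_one, one_mul, mul_one]

/-- **`Γ_r = GSp_δ(ℚ) ∩ K_δ(N)` for every `r ∈ K_δ(1) = GSp_δ(ℤ̂)`** (since `K_δ(1)` normalises `K_δ(N)`,
★ `principalLevelSubgroup_normal_in_one`): at principal level all pieces with representatives in `K_δ(1)` carry the
SAME arithmetic group (= `Γ_δ(N)`, ★ R60-11). [cite: Milne2005ShimuraVarieties, §6 p. 70 and Lemma 5.13 p. 57]
[cite: Deligne1971TravauxShimura, Exemple 4.16 p. 150] -/
theorem arithLevel_principalLevelSubgroup_of_mem_one (N : ℕ) {r : gspFinAdelic δ}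
    (hr : r ∈ principalLevelSubgroup δ 1) :
    arithLevel δ (principalLevelSubgroup δ N) r = (principalLevelSubgroup δ N).comap (gspRationalToFinAdelic δ) := by
  ext γ
  rw [mem_arithLevel_iff, Subgroup.mem_comap]
  constructor
  · intro h
    have := principalLevelSubgroup_normal_in_one δ N hr h
    rwa [← mul_assoc, ← mul_assoc, mul_inv_cancel, one_mul, mul_inv_cancel_right] at this
  · intro h
    have := principalLevelSubgroup_normal_in_one δ N ((principalLevelSubgroup δ 1).inv_mem hr) h
    rwa [inv_inv] at this

/-- The adelic image of the half-swap is the adelic half-swap. [cite: Milne2005ShimuraVarieties, §6 p. 70] -/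
theorem coe_gspRationalToFinAdelic_halfSwap :
    (gspRationalToFinAdelic δ ⟨halfSwap ℚ g, halfSwap_mem_gspRational δ⟩ : GL (Fin g ⊕ Fin g) finAdeleQ) =
      halfSwap finAdeleQ g := by
  rw [coe_gspRationalToFinAdelic]
  exact map_halfSwap ℚ (algebraMap ℚ finAdeleQ)

/-- The adelic half-swap is `≡ 1 (mod 1·𝓞̂)`, i.e. integral: its entries are `0, ±1`.
[cite: Deligne1971TravauxShimura, Exemple 4.16 p. 150] -/
theorem isCongOne_one_halfSwap :
    IsCongOne 1 ((halfSwap finAdeleQ g : GL (Fin g ⊕ Fin g) finAdeleQ) : Matrix (Fin g ⊕ Fin g) (Fin g ⊕ Fin g) finAdeleQ) := by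
  have h1 : (1 : finAdeleQ) ∈ levelIdeal 1 :=
    mem_levelIdeal_iff.2 ⟨1, Subring.one_mem _, by rw [Nat.cast_one, one_mul]⟩
  intro i j
  rw [Matrix.sub_apply, coe_halfSwap, Matrix.one_apply]
  rcases i with i | i <;> rcases j with j | j
  · rw [Matrix.fromBlocks_apply₁₁, Matrix.one_apply]
    simp only [Sum.inl.injEq]
    rw [sub_self]
    exact (levelIdeal 1).zero_mem
  · rw [Matrix.fromBlocks_apply₁₂, Matrix.zero_apply, if_neg Sum.inl_ne_inr, sub_zero]
    exact (levelIdeal 1).zero_mem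
  · rw [Matrix.fromBlocks_apply₂₁, Matrix.zero_apply, if_neg Sum.inr_ne_inl, sub_zero]
    exact (levelIdeal 1).zero_mem
  · rw [Matrix.fromBlocks_apply₂₂, Matrix.neg_apply, Matrix.one_apply]
    simp only [Sum.inr.injEq]
    split_ifs
    · rw [show (-1 - 1 : finAdeleQ) = -(1 + 1) by ring]
      exact (levelIdeal 1).neg_mem ((levelIdeal 1).add_mem h1 h1)
    · rw [neg_zero, sub_zero]
      exact (levelIdeal 1).zero_mem

/-- **The half-swap lies in `K_δ(1) = GSp_δ(ℤ̂)`** (it is an integral matrix equal to its own inverse).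
[cite: Milne2005ShimuraVarieties, §6 p. 70] [cite: Deligne1971TravauxShimura, Exemple 4.16 p. 150] -/
theorem gspRationalToFinAdelic_halfSwap_mem_principalLevelSubgroup_one :
    gspRationalToFinAdelic δ ⟨halfSwap ℚ g, halfSwap_mem_gspRational δ⟩ ∈ principalLevelSubgroup δ 1 := by
  rw [mem_principalLevelSubgroup_iff, coe_gspRationalToFinAdelic_halfSwap, halfSwap_inv]
  exact ⟨isCongOne_one_halfSwap, isCongOne_one_halfSwap⟩

/-- Hence `γ₀ r ∈ K_δ(1)` for `r ∈ K_δ(1)`, and **`Γ_{γ₀r} = Γ_r = GSp_δ(ℚ) ∩ K_δ(N)`**: the two `X⁺`-families of a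
principal-level piece carry the same arithmetic group. [cite: Milne2005ShimuraVarieties, §6 p. 70 and Lemma 5.13 p. 57] -/
theorem arithLevel_halfSwap_mul_eq_of_mem_one (N : ℕ) {r : gspFinAdelic δ} (hr : r ∈ principalLevelSubgroup δ 1) :
    arithLevel δ (principalLevelSubgroup δ N)
        (gspRationalToFinAdelic δ ⟨halfSwap ℚ g, halfSwap_mem_gspRational δ⟩ * r) =
      arithLevel δ (principalLevelSubgroup δ N) r := by
  rw [arithLevel_principalLevelSubgroup_of_mem_one δ N hr,
    arithLevel_principalLevelSubgroup_of_mem_one δ N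
      ((principalLevelSubgroup δ 1).mul_mem (gspRationalToFinAdelic_halfSwap_mem_principalLevelSubgroup_one δ) hr)]

end SiegelShimuraSet

end Literature.AlgebraicGeometry.ModuliOfAbelianVarieties

end
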